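import Literature.AlgebraicTopology.SingularHomology.CapProductSupport
import Literature.Topology.FourManifolds.HomotopySpheresE8HandlebodyReduction
import HarnessLib

/-!
# The `E₈` table of Milnor's plumbing from Kronecker numbers in the vertex models

Topic `Literature/Topology/FourManifolds`; pure-proof companion of the named fact
`Literature.Topology.FourManifolds.HomotopySphere.exists_intersectionForm_equivalent_e8Form`
(`HomotopySpheresBPOrderSignatureLeaves.lean`), sequel of
`HomotopySpheresE8HandlebodyReduction.lean` (Kosinski VI.(12.2) ⟸: the intersection table of
eight middle-dimensional classes of the closed model `M̂ = W ∪ cone(bM)` of a handlebody,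
`2` on the diagonal and `±1` exactly at the edges of the `E₈` tree, makes `bW` a homotopy sphere
bounding the `E₈` form) and of `HomotopySpheresE8TableAssembly.lean` (the table from local
models by collapses). A. Kosinski, *Differential Manifolds* (1993), VI.12: the entries of the
intersection matrix of the presentation spheres `Σ₁, …, Σ₈` of `M(4n)` are `[Σᵢ : Σᵢ] = 2`
((12.4), the Euler number of the tangent bundle of `S²ⁿ`) and `[Σᵢ : Σⱼ] = ±1` or `0` ((12.3),
one transverse crossing in a plumbing box, or none).

Here ALL entries — including the off-diagonal ones — are reduced to KRONECKER NUMBERS in the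
vertex models, so that no model of a two-fold plumbing and no relative cup product is needed.
For the closed model `X = M̂` with its class `ζ = ẑ`, collapses `πᵥ : X → Yᵥ` onto the vertex
models (the closed models of the tubes), classes `uᵥ ∈ Hᵏ(Yᵥ)` vanishing off a set `Zᵥ` (the
Thom class, vanishing off the zero section) and open pieces `Uᵥ ⊇ πᵥ⁻¹(Zᵥ)` with `Hₖ(Uᵥ) = ℤ gᵥ`
(the tubes, generated by their core spheres), the locality of the cap product
(`exists_capProduct_eq_smul_map_of_map_eq_zero`, `CapProductSupport.lean`: the Poincaré dual
`aᵥ ⌢ ζ` of `aᵥ = πᵥ^* uᵥ` is a class of the piece `Uᵥ`) and the projection formula give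
`aᵥ ⌢ ζ = r Gᵥ` as soon as `uᵥ ⌢ πᵥ₊ ζ = r · πᵥ₊ Gᵥ` in the vertex model (`r = ±1`, the
orientation bookkeeping), whence (`⟨a ⌣ b, c⟩ = ⟨b, a ⌢ c⟩`)

  `⟨aᵥ ⌣ a_w, ζ⟩ = r ⟨u_w, π_w₊ Gᵥ⟩`  (`kroneckerPairing_cupProduct_map_map_eq`),

the Kronecker number of the Thom class of the `w`-th model on the image of the `v`-th core sphere:
`2` for `w = v` (the zero section, (12.4)), `±1` for an edge (a fibre sphere, (12.3)), `0`
otherwise (the point `∞`). `HomotopySphere.exists_intersectionForm_equivalent_e8Form_of_kroneckerData`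
packages this with `exists_intersectionForm_equivalent_e8Form_of_handlebody`: the named fact
follows from the handlebody datum of that theorem with the table replaced by these Kronecker data.
Everything is proved; no definitions, no named facts (D-0026).

## References

* A. Kosinski, *Differential Manifolds*, Academic Press 1993: VI.12, pp. 119–122 ((12.2)–(12.4),
  `M(4n)` and `Γ₈` on p. 122), IX.(7.5) p. 188, X §6 p. 216. [Kosinski1993]
* J. Milnor, J. Stasheff, *Characteristic classes*, Princeton 1974, §11, Thm. 11.3 and
  Problem 11-C (the dual class of a submanifold and the Thom class of its normal bundle).
  [MilnorStasheff1974]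
* A. Hatcher, *Algebraic Topology*, CUP 2002, §3.3 p. 241 (`⟨a ⌣ b, c⟩ = ⟨b, a ⌢ c⟩`, the
  projection formula). [HatcherAT2002]
-/

open scoped Manifold ContDiff Topology
open Set Function CategoryTheory CategoryTheory.Limits

noncomputable section

namespace Literature.Topology.FourManifolds

open Literature.AlgebraicTopology.SingularHomology

/-! ### The cup-product table from Kronecker data (generalities) -/

section Generalities

variable {X : Type} [TopologicalSpace X] {k N : ℕ}

/-- A class pulled back along `π : X → Y` from a class of `Y` vanishing off a set `Z` vanishes
off `π ⁻¹' Z`. [folklore] -/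
theorem map_subsetIncl_compl_map_eq_zero {Y : Type} [TopologicalSpace Y] (π : C(X, Y))
    (Z : Set Y) (u : singularCohomology ℤ ℤ Y k)
    (hu : singularCohomology.map ℤ ℤ (subsetIncl Zᶜ) k u = 0) :
    singularCohomology.map ℤ ℤ (subsetIncl (π ⁻¹' Z)ᶜ) k (singularCohomology.map ℤ ℤ π k u) = 0 := by
  -- `π ∘ (incl (π⁻¹ Z)ᶜ) = incl Zᶜ ∘ π'`
  set π' : C(↥((π ⁻¹' Z)ᶜ), ↥(Zᶜ)) := ⟨fun x => ⟨π x.1, x.2⟩, by fun_prop⟩ with hπ'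
  have hcomp : π.comp (subsetIncl (π ⁻¹' Z)ᶜ) = (subsetIncl Zᶜ).comp π' := by ext x; rfl
  rw [← ModuleCat.comp_apply, ← singularCohomology.map_comp, hcomp, singularCohomology.map_comp,
    ModuleCat.comp_apply, hu, map_zero]

/-- **The cup-product table of collapsed Thom classes from Kronecker data.** Let `ζ ∈ H_N(X)`
(`N = 2k`), and for each vertex `v`: a space `Yᵥ` with a map `πᵥ : X → Yᵥ`, a class
`uᵥ ∈ Hᵏ(Yᵥ)` vanishing off a set `Zᵥ ⊆ Yᵥ`, an open `Uᵥ ⊇ πᵥ⁻¹(Zᵥ)` of `X` with `πᵥ⁻¹(Zᵥ)`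
closed, whose `Hₖ` is generated by one class `gᵥ` with image `Gᵥ ∈ Hₖ(X)`, such that
`tᵥ = πᵥ₊ Gᵥ` is not torsion and `uᵥ ⌢ πᵥ₊ ζ = r • tᵥ` for one common `r`. Then for
`aᵥ = πᵥ^* uᵥ`:  `⟨aᵥ ⌣ a_w, ζ⟩ = r ⟨u_w, π_w₊ Gᵥ⟩`.
Proof: `aᵥ` vanishes off `πᵥ⁻¹(Zᵥ) ⊆ Uᵥ`, so `aᵥ ⌢ ζ = m Gᵥ` by locality of the cap product
(`exists_capProduct_eq_smul_map_of_map_eq_zero`); the projection formula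
`πᵥ₊(aᵥ ⌢ ζ) = uᵥ ⌢ πᵥ₊ ζ = r tᵥ` gives `m = r`; and `⟨aᵥ ⌣ a_w, ζ⟩ = ⟨a_w, aᵥ ⌢ ζ⟩`
(`kroneckerPairing_cupProduct`). (Kosinski 1993, VI.12: the intersection matrix of the
presentation spheres of `M(4n)` — here its cohomological form, with every entry read as a
Kronecker number in a vertex model; Milnor–Stasheff 1974, §11, Problem 11-C: the dual class of a
submanifold restricts to the Thom class of its normal bundle.)
[cite: Kosinski1993, VI.12 pp. 119–122] [cite: MilnorStasheff1974, §11 Problem 11-C] [cite: HatcherAT2002, §3.3 p. 241] -/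
theorem kroneckerPairing_cupProduct_map_map_eq (hk : k + k = N) (ζ : singularHomology ℤ ℤ X N)
    {ι : Type} (Y : ι → Type) [∀ v, TopologicalSpace (Y v)] (π : ∀ v, C(X, Y v))
    (u : ∀ v, singularCohomology ℤ ℤ (Y v) k) (Z : ∀ v, Set (Y v))
    (huZ : ∀ v, singularCohomology.map ℤ ℤ (subsetIncl (Z v)ᶜ) k (u v) = 0)
    (U : ι → Set X) (hUo : ∀ v, IsOpen (U v)) (hKc : ∀ v, IsClosed ((π v) ⁻¹' Z v))
    (hKU : ∀ v, (π v) ⁻¹' Z v ⊆ U v)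
    (g : ∀ v, singularHomology ℤ ℤ ↥(U v) k)
    (hg : ∀ v (y : singularHomology ℤ ℤ ↥(U v) k), ∃ m : ℤ, y = m • g v)
    (htors : ∀ v (m : ℤ), m • singularHomology.map ℤ ℤ (π v) k
      (singularHomology.map ℤ ℤ (subsetIncl (U v)) k (g v)) = 0 → m = 0)
    (r : ℤ) (hcap : ∀ v, capProduct hk (u v) (singularHomology.map ℤ ℤ (π v) N ζ) =
      r • singularHomology.map ℤ ℤ (π v) k (singularHomology.map ℤ ℤ (subsetIncl (U v)) k (g v)))
    (v w : ι) :
    kroneckerPairing ℤ ℤ X N (cupProduct hk (singularCohomology.map ℤ ℤ (π v) k (u v))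
        (singularCohomology.map ℤ ℤ (π w) k (u w))) ζ =
      r * kroneckerPairing ℤ ℤ (Y w) k (u w) (singularHomology.map ℤ ℤ (π w) k
        (singularHomology.map ℤ ℤ (subsetIncl (U v)) k (g v))) := by
  -- `aᵥ ⌢ ζ = m • Gᵥ` (the `ℤ`-module scalar multiplication of the corollary is rewritten as
  -- the `zsmul` of the additive group, `int_smul_eq_zsmul`)
  obtain ⟨m, hm⟩ := exists_capProduct_eq_smul_map_of_map_eq_zero ℤ ℤ hk (hUo v) (hKc v) (hKU v)
    (singularCohomology.map ℤ ℤ (π v) k (u v))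
    (map_subsetIncl_compl_map_eq_zero (π v) (Z v) (u v) (huZ v)) ζ (g v) (fun y => by
      obtain ⟨m, hm⟩ := hg v y
      exact ⟨m, hm.trans (int_smul_eq_zsmul _ m (g v)).symm⟩)
  replace hm := hm.trans (int_smul_eq_zsmul _ m _)
  -- `m = r` by the projection formula
  have hmr : m = r := by
    have e := capProduct_map (π v) hk (u v) ζ
    rw [hm, map_zsmul, hcap v] at e
    have e' : (m - r) • singularHomology.map ℤ ℤ (π v) k
        (singularHomology.map ℤ ℤ (subsetIncl (U v)) k (g v)) = 0 := by
      rw [sub_zsmul]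
      simpa [sub_eq_add_neg] using sub_eq_zero.2 e
    have := htors v (m - r) e'
    omega
  rw [kroneckerPairing_cupProduct, hm, hmr, map_zsmul, zsmul_eq_mul, Int.cast_id, kroneckerPairing_map]

end Generalities

/-! ### The `E₈` leaf from Kronecker data -/

namespace HomotopySphere

/-- **The `E₈` leaf from `M(4m)`, its homology, and KRONECKER DATA for its table** (Kosinski
1993, VI.12 with (12.3)–(12.4)). As `exists_intersectionForm_equivalent_e8Form_of_handlebody`
(a closed simply connected smooth `n`-manifold `M = ∂M(4m)` with a smooth orientation, a
connected s-parallelizable null-cobordism `c` with `c.W = M(4m)`, a relative fundamental class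
`z`, `Hᵢ(W; ℤ) = 0` for `0 < i ≠ 2m`, `H₂ₘ(W; ℤ)` free of rank `≤ 8`), with the table hypothesis
replaced by: eight vertex models `(Yᵥ, πᵥ, uᵥ, Zᵥ)` (`uᵥ ∈ Hᵏ(Yᵥ)` vanishing off `Zᵥ`, e.g. the
Thom class of the closed model of a tube vanishing off the zero section), open pieces
`Uᵥ ⊇ πᵥ⁻¹(Zᵥ)` of the closed model `M̂` with `Hₖ(Uᵥ) = ℤ gᵥ` (the core spheres), such that the
images `tᵥ = πᵥ₊ Gᵥ` are not torsion and `uᵥ ⌢ πᵥ₊ ẑ = r tᵥ` for a common `r = ±1` (the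
orientation bookkeeping of the vertex model), and the KRONECKER NUMBERS
`⟨uᵥ, πᵥ₊ Gᵥ⟩ = 2` ((12.4): the zero section of the tangent disc bundle of `S²ᵐ`,
`φ_*(τ₂ₘ) = 2`) and `|⟨u_w, π_w₊ Gᵥ⟩| = (Γ₈)ᵥ_w` for `v ≠ w` ((12.3): a fibre sphere for an edge,
the point `∞` otherwise). By `kroneckerPairing_cupProduct_map_map_eq` the classes
`aᵥ = πᵥ^* uᵥ` have the table `2r` on the diagonal and `|·| = Γ₈` off it (Γ₈ is symmetric), and
`exists_intersectionForm_equivalent_e8Form_of_handlebody` applies.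
[cite: Kosinski1993, VI.12 (pp. 119–122: M(4n), Γ₈ on p. 122, (12.1)–(12.4)), VI.(11.5) and IX.(7.5) (p. 188); used in Ch. X §6, proof of Prop. 6.2(a), p. 216] -/
theorem exists_intersectionForm_equivalent_e8Form_of_kroneckerData
    (H : ∀ (n m : ℕ) (h : n + 1 = 4 * m) (hm : 1 < m),
      ∃ (M : Type) (_ : TopologicalSpace M) (_ : T2Space M) (_ : SecondCountableTopology M)
        (_ : ChartedSpace (EuclideanSpace ℝ (Fin n)) M) (_ : IsManifold (𝓡 n) ∞ M)
        (_ : CompactSpace M) (_ : SimplyConnectedSpace M) (_ : SmoothOrientation (𝓡 n) M)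
        (c : NullCobordism n M) (_ : ConnectedSpace c.W)
        (z : relativeSingularHomology ℤ ℤ c.W ((𝓡∂ (n + 1)).boundary c.W) (n + 1)),
        IsStablyParallelizable (𝓡∂ (n + 1)) c.W ∧
        IsRelFundamentalClass ℤ ((𝓡∂ (n + 1)).boundary c.W) z ∧
        (∀ i, 0 < i → i ≠ 2 * m → IsZero (singularHomology ℤ ℤ c.W i)) ∧
        Module.Free ℤ (singularHomology ℤ ℤ c.W (2 * m)) ∧
        Module.finrank ℤ (singularHomology ℤ ℤ c.W (2 * m)) ≤ 8 ∧
        ∃ (Y : Fin 8 → Type) (_ : ∀ v, TopologicalSpace (Y v))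
          (π : ∀ v, C(ClosedModel n c.W, Y v))
          (u : ∀ v, singularCohomology ℤ ℤ (Y v) (2 * m)) (Z : ∀ v, Set (Y v))
          (U : Fin 8 → Set (ClosedModel n c.W))
          (g : ∀ v, singularHomology ℤ ℤ ↥(U v) (2 * m)) (r : ℤ),
          (r = 1 ∨ r = -1) ∧
          (∀ v, singularCohomology.map ℤ ℤ (subsetIncl (Z v)ᶜ) (2 * m) (u v) = 0) ∧
          (∀ v, IsOpen (U v)) ∧ (∀ v, IsClosed ((π v) ⁻¹' Z v)) ∧ (∀ v, (π v) ⁻¹' Z v ⊆ U v) ∧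
          (∀ v (y : singularHomology ℤ ℤ ↥(U v) (2 * m)), ∃ a : ℤ, y = a • g v) ∧
          (∀ v (a : ℤ), a • singularHomology.map ℤ ℤ (π v) (2 * m)
            (singularHomology.map ℤ ℤ (subsetIncl (U v)) (2 * m) (g v)) = 0 → a = 0) ∧
          (∀ v, capProduct (show 2 * m + 2 * m = n + 1 by omega) (u v)
              (singularHomology.map ℤ ℤ (π v) (n + 1)
                (c.closedModelClass ℤ ℤ (show 1 ≤ n by omega) z)) =
            r • singularHomology.map ℤ ℤ (π v) (2 * m)
              (singularHomology.map ℤ ℤ (subsetIncl (U v)) (2 * m) (g v))) ∧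
          (∀ v, kroneckerPairing ℤ ℤ (Y v) (2 * m) (u v) (singularHomology.map ℤ ℤ (π v) (2 * m)
            (singularHomology.map ℤ ℤ (subsetIncl (U v)) (2 * m) (g v))) = 2) ∧
          ∀ v w, v ≠ w → |kroneckerPairing ℤ ℤ (Y w) (2 * m) (u w)
            (singularHomology.map ℤ ℤ (π w) (2 * m)
              (singularHomology.map ℤ ℤ (subsetIncl (U v)) (2 * m) (g v)))| =
            kosinskiGamma8 v w) :
    exists_intersectionForm_equivalent_e8Form := by
  refine exists_intersectionForm_equivalent_e8Form_of_handlebody fun n m h hm => ?_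
  obtain ⟨M, i₁, i₂, i₃, i₄, i₅, i₆, i₇, o, c, i₈, z, hspar, hz, hW, hfree, hr8, Y, _, π, u, Z, U, g,
    r, hr, huZ, hUo, hKc, hKU, hg, htors, hcap, hdiag, hoff⟩ := H n m h hm
  refine ⟨M, i₁, i₂, i₃, i₄, i₅, i₆, i₇, o, c, i₈, z, hspar, hz, hW, hfree, hr8,
    fun v => singularCohomology.map ℤ ℤ (π v) (2 * m) (u v), ?_, ?_⟩
  · have key := fun v => kroneckerPairing_cupProduct_map_map_eq
      (show 2 * m + 2 * m = n + 1 by omega) (c.closedModelClass ℤ ℤ (show 1 ≤ n by omega) z)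
      Y π u Z huZ U hUo hKc hKU g hg htors r hcap v v
    rcases hr with rfl | rfl
    · left
      intro v
      rw [key v, hdiag v, one_mul]
    · right
      intro v
      rw [key v, hdiag v]
      norm_num
  · intro v w hvw
    rw [kroneckerPairing_cupProduct_map_map_eq (show 2 * m + 2 * m = n + 1 by omega)
      (c.closedModelClass ℤ ℤ (show 1 ≤ n by omega) z) Y π u Z huZ U hUo hKc hKU g hg htors r
      hcap v w, abs_mul]
    have hr1 : |r| = 1 := by rcases hr with rfl | rfl <;> norm_num
    rw [hr1, one_mul, hoff v w hvw]

end HomotopySphere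

end Literature.Topology.FourManifolds
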